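import Summits.FinalStateConjecture.FinalStateConjecture.Theorems.RobustClausewiseGenericityAssembly
import HarnessLib

/-!
# Radial escape from finitely many `C¹` walls; robust escapability from a wall structure

Helper for crux `GenericCensorshipCollarMargin` (stmt-FinalStateConjecture-10809, route `BartnikGapSettling`,
line `hair-vacates-the-margin`) and for every "walls in general position" clause of route
`RobustClausewiseGenericity` (`ThirdLawRobust`, stmt-10132; `CensorshipRobust`, stmt-10131): the ANALYTIC HALF
of the intended proofs, landed so that the promoted physical items can be stated against it.

* `exists_radial_escape` — one `C¹` function `φ` on a normed space which either misses `0` at the origin or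
  has `dφ(0) v ≠ 0` is non-zero at `t • v` for all small `t ≠ 0`.
* `exists_open_dense_radial_escape` — finitely many `C¹` walls `{φⱼ = 0}`, each missing the origin or
  non-degenerate there (`dφⱼ(0) ≠ 0`), leave an OPEN DENSE set of directions `v` along which ALL `φⱼ (t • v)`
  are non-zero for small `t ≠ 0` (finite intersection of complements of proper closed hyperplanes).
* `robustlyEscapable_of_walls` — **WALL STRUCTURE ⇒ ROBUST ESCAPABILITY**: if every tame probe through `d`
  enriches to a tame `G₁` such that along every further tame enrichment `G₂ : ℝᵖ → data` the bad set
  `{c | ¬ Q (G₂ c)}` near `c = 0` is contained in the union of finitely many such walls, then `Q` is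
  robustly escapable at `d` (`Theorems.RobustClausewiseGenericity.RobustlyEscapable`, the route legend). This is
  the exact shape in which the hair line's open stub `MarginWall3SF` (walls = late horizon charges
  `𝔔ⱼ ∘ G₂` of the would-be extremal holes, Lucietti–Reall 2012) and `ThirdLawRobust` (wall = final parameter
  ratio, Angelopoulos–Kehle–Unger's `C¹` threshold) are meant to be proved: the physics supplies the walls and
  their transversality, this file the genericity.

## References

* D. Christodoulou, CQG 16 (1999) A23–A35, p. A24 (families of data; positive codimension). [Christodoulou1999]
* Y. Angelopoulos, C. Kehle, R. Unger, *Nonlinear stability of extremal Reissner–Nordström …* (2024/2026),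
  Thm 2 (the asymptotically extremal set is a `C¹` hypersurface, the parameter ratio a `C¹` submersion — the
  model wall). [AngelopoulosKehleUnger2024]
-/

noncomputable section

namespace Summit.FinalStateConjecture.FinalStateConjecture.Theorems.RobustClausewiseGenericity

open Literature.Geometry.Lorentzian
open Set Function Filter Metric
open scoped Manifold ContDiff Topology

-- D-0017: single-problem summit, `Summit.<S>.<S>.…` by design.
set_option linter.dupNamespace false

section Walls

variable {E : Type*} [NormedAddCommGroup E] [NormedSpace ℝ E]

/-- **Radial escape from one `C¹` wall** which either misses `0` or is non-degenerate along the direction `v`: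
`φ (t • v) ≠ 0` for all small `t ≠ 0` (continuity at `0`, resp. `t ↦ φ(t v)` has non-zero derivative at `0`).
[cite: Christodoulou1999, p. A24] -/
theorem exists_radial_escape {φ : E → ℝ} (hφ : ContDiff ℝ 1 φ) {v : E}
    (hv : φ 0 ≠ 0 ∨ fderiv ℝ φ 0 v ≠ 0) :
    ∃ δ : ℝ, 0 < δ ∧ ∀ t : ℝ, t ≠ 0 → |t| < δ → φ (t • v) ≠ 0 := by
  have hev : ∀ᶠ t in 𝓝[≠] (0 : ℝ), φ (t • v) ≠ 0 := by
    rcases hv with h0 | hD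
    · have hc : ContinuousAt (fun t : ℝ => φ (t • v)) 0 :=
        (hφ.continuous.comp (continuous_id.smul continuous_const)).continuousAt
      have h00 : φ ((0 : ℝ) • v) ≠ 0 := by rwa [zero_smul]
      exact (hc.eventually_ne h00).filter_mono nhdsWithin_le_nhds
    · have h1 : HasDerivAt (fun s : ℝ => s • v) ((1 : ℝ) • v) 0 := (hasDerivAt_id (0 : ℝ)).smul_const v
      rw [one_smul] at h1
      have h2 := ((hφ.differentiable one_ne_zero) ((0 : ℝ) • v)).hasFDerivAt.comp_hasDerivAt (0 : ℝ) h1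
      rw [zero_smul] at h2
      exact h2.eventually_ne hD
  rw [eventually_nhdsWithin_iff, Metric.eventually_nhds_iff] at hev
  obtain ⟨δ, hδ, h⟩ := hev
  exact ⟨δ, hδ, fun t ht htδ => h (by simpa [Real.dist_eq] using htδ) ht⟩

/-- **Finitely many `C¹` walls, each missing `0` or non-degenerate at `0`, leave an OPEN DENSE set of radial
escape directions**: the set `⋂ⱼ ({φⱼ 0 ≠ 0} ∪ {v | dφⱼ(0) v ≠ 0})` is a finite intersection of open dense sets
(complements of proper closed hyperplanes, `dense_setOf_apply_ne_zero`), and along each of its directions all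
walls are escaped for `|t|` below the least of finitely many radii. [cite: Christodoulou1999, p. A24] -/
theorem exists_open_dense_radial_escape [CompleteSpace E] {J : ℕ} (φ : Fin J → E → ℝ)
    (hφ : ∀ j, ContDiff ℝ 1 (φ j)) (hnd : ∀ j, φ j 0 ≠ 0 ∨ fderiv ℝ (φ j) 0 ≠ 0) :
    ∃ U : Set E, IsOpen U ∧ Dense U ∧
      ∀ v ∈ U, ∃ δ : ℝ, 0 < δ ∧ ∀ t : ℝ, t ≠ 0 → |t| < δ → ∀ j, φ j (t • v) ≠ 0 := by
  let U : Fin J → Set E := fun j => {v | φ j 0 ≠ 0} ∪ {v | fderiv ℝ (φ j) 0 v ≠ 0}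
  have hUo : ∀ j, IsOpen (U j) := fun j =>
    isOpen_const.union (isOpen_ne_fun (fderiv ℝ (φ j) 0).continuous continuous_const)
  have hUd : ∀ j, Dense (U j) := by
    intro j
    rcases hnd j with h0 | hD
    · exact dense_univ.mono fun v _ => Or.inl h0
    · obtain ⟨w, hw⟩ := DFunLike.ne_iff.1 hD
      exact (dense_setOf_apply_ne_zero _ (by simpa using hw)).mono fun v hv => Or.inr hv
  refine ⟨⋂ j, U j, isOpen_iInter_of_finite hUo, dense_iInter_of_isOpen hUo hUd, fun v hv => ?_⟩
  have hvj : ∀ j, φ j 0 ≠ 0 ∨ fderiv ℝ (φ j) 0 v ≠ 0 := fun j => by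
    have := Set.mem_iInter.1 hv j
    exact this
  choose δ hδpos hδesc using fun j => exists_radial_escape (hφ j) (hvj j)
  by_cases hJ : J = 0
  · subst hJ
    exact ⟨1, one_pos, fun t _ _ j => j.elim0⟩
  · haveI : Nonempty (Fin J) := ⟨⟨0, Nat.pos_of_ne_zero hJ⟩⟩
    obtain ⟨j₀, hj₀⟩ := Finite.exists_min δ
    exact ⟨δ j₀, hδpos j₀, fun t ht htδ j => hδesc j t ht (htδ.trans_le (hj₀ j))⟩

end Walls

section Robust

variable {X : Type} [TopologicalSpace X] [ChartedSpace E3 X] [IsManifold (𝓡 3) ∞ X]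

/-- **Wall structure ⇒ robust escapability.** Suppose every tame probe `G` through `d` enriches (injective linear
`L`, tame `G₁`, `G₁ ∘ L = G`) so that along EVERY further tame enrichment `G₂ : ℝᵖ → data` there are finitely many
`C¹` functions `φⱼ : ℝᵖ → ℝ`, each with `φⱼ 0 ≠ 0` or `dφⱼ(0) ≠ 0`, and a radius `ε > 0` such that every parameter
`c` with `‖c‖ < ε` off all the walls (`φⱼ c ≠ 0` for all `j`) is good (`Q (G₂ c)`). Then `Q` is robustly
escapable at `d`: the open dense direction set is that of `exists_open_dense_radial_escape`, and along `v` in it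
one takes `|t| < min δ_v (ε / (‖v‖ + 1))`. [cite: Christodoulou1999, p. A24] -/
theorem robustlyEscapable_of_walls {d : InitialDataSet (𝓡 3) X} {Q : InitialDataSet (𝓡 3) X → Prop}
    (h : ∀ (m : ℕ) (G : EuclideanSpace ℝ (Fin m) → InitialDataSet (𝓡 3) X), Tame d m G →
      ∃ (n : ℕ) (G₁ : EuclideanSpace ℝ (Fin n) → InitialDataSet (𝓡 3) X)
        (L : EuclideanSpace ℝ (Fin m) →ₗ[ℝ] EuclideanSpace ℝ (Fin n)),
        Function.Injective L ∧ Tame d n G₁ ∧ (∀ c, G₁ (L c) = G c) ∧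
        ∀ (p : ℕ) (G₂ : EuclideanSpace ℝ (Fin p) → InitialDataSet (𝓡 3) X)
          (L' : EuclideanSpace ℝ (Fin n) →ₗ[ℝ] EuclideanSpace ℝ (Fin p)),
          Function.Injective L' → Tame d p G₂ → (∀ c, G₂ (L' c) = G₁ c) →
          ∃ (J : ℕ) (φ : Fin J → EuclideanSpace ℝ (Fin p) → ℝ) (ε : ℝ), 0 < ε ∧
            (∀ j, ContDiff ℝ 1 (φ j)) ∧ (∀ j, φ j 0 ≠ 0 ∨ fderiv ℝ (φ j) 0 ≠ 0) ∧
            ∀ c : EuclideanSpace ℝ (Fin p), ‖c‖ < ε → (∀ j, φ j c ≠ 0) → Q (G₂ c)) :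
    RobustlyEscapable d Q := by
  intro m G hG
  obtain ⟨n, G₁, L, hL, hT, hGL, H⟩ := h m G hG
  refine ⟨n, G₁, L, hL, hT, hGL, fun p G₂ L' hL' hT₂ hGL' => ?_⟩
  obtain ⟨J, φ, ε, hε, hφ, hnd, hgood⟩ := H p G₂ L' hL' hT₂ hGL'
  obtain ⟨U, hUo, hUd, hU⟩ := exists_open_dense_radial_escape φ hφ hnd
  refine ⟨U, hUo, hUd, fun v hv => ?_⟩
  obtain ⟨δ, hδ, hesc⟩ := hU v hv
  have hv1 : 0 < ‖v‖ + 1 := by positivity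
  refine ⟨min δ (ε / (‖v‖ + 1)), lt_min hδ (div_pos hε hv1), fun t ht htδ => ?_⟩
  refine hgood (t • v) ?_ (hesc t ht (htδ.trans_le (min_le_left _ _)))
  -- `‖t • v‖ = |t| ‖v‖ < ε`
  have htε : |t| < ε / (‖v‖ + 1) := htδ.trans_le (min_le_right _ _)
  have h1 : |t| * (‖v‖ + 1) < ε := (lt_div_iff₀ hv1).1 htε
  calc ‖t • v‖ = |t| * ‖v‖ := by rw [norm_smul, Real.norm_eq_abs]
    _ ≤ |t| * (‖v‖ + 1) := mul_le_mul_of_nonneg_left (by linarith) (abs_nonneg t)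
    _ < ε := h1

end Robust

end Summit.FinalStateConjecture.FinalStateConjecture.Theorems.RobustClausewiseGenericity

end
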